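import Mathlib
import HarnessLib
import Summits.Parity.BatemanHorn.Theorems.IsogenyRedeiSplitBlockJacobiCornerMbbParamsA

/-!
# `stub_mbb_of_boxInputs` (line `Sketch`, crux `SplitBlockJacobiCorner`, stmt-Parity-15002):
# size bookkeeping, part B — the two numerical inequalities

With `p = P₁`, `0 < η < 2`, `δ₀ = η/50`, `ε = η/1000`, `X = P₁P₂ ≤ 8p^{2+δ₀}`, every size entering
the final bound is a monomial in `p`:  `L = log(4X) ≤ κ_L p^{ε}`, `D = C(4X)^ε ≤ κ_D p^{3ε}`,
`U ≤ p^{η/10}`, `1/U ≤ p^{−2η/25}`, `X^{1−η} ≤ 8 p^{2+δ₀−2η}`, while the target dominates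
`p^{2−2δ₀} ≤ X^{1−δ₀}`.  Hence the prime-power term (`fact_E`) and the five Vaughan terms
(`fact_final`) are `≤ X^{1−δ₀}/4`, resp. `≤ 3X^{1−δ₀}/4`, under six explicit largeness hypotheses
`κ_i ≤ p^{a_i}`.
-/

noncomputable section

open Real

namespace Summit.Parity.BatemanHorn.Cruxes.SplitBlockJacobiCorner.Sketch.MbbOfBoxInputs

/-! ### Monomial bounds for `L`, `D`, `X^{1−η}`, `X^{1−δ₀}` -/

/-- `log(4X) ≤ (log 32 + 3/ε) p^ε` for `X ≤ 8p^{2+δ₀}`, `δ₀ ≤ 1`, `p ≥ 1`, `ε > 0`. [folklore] -/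
theorem L_le {p X δ₀ ε : ℝ} (hp : 1 ≤ p) (hε : 0 < ε) (hδ1 : δ₀ ≤ 1) (hX0 : 0 < X)
    (hX : X ≤ 8 * p ^ (2 + δ₀)) : Real.log (4 * X) ≤ (Real.log 32 + 3 / ε) * p ^ ε := by
  have hp0 : 0 < p := by linarith
  have h1 : Real.log (4 * X) ≤ Real.log (32 * p ^ (2 + δ₀)) :=
    Real.log_le_log (by positivity) (by linarith)
  have e : Real.log (32 * p ^ (2 + δ₀)) = Real.log 32 + (2 + δ₀) * Real.log p := by
    rw [Real.log_mul (by norm_num) (by positivity), Real.log_rpow hp0]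
  rw [e] at h1
  have h2 : Real.log p ≤ p ^ ε / ε := Real.log_le_rpow_div hp0.le hε
  have h3 : 0 ≤ Real.log p := Real.log_nonneg hp
  have h4 : (1 : ℝ) ≤ p ^ ε := one_le_rpow hp hε.le
  have h5 : (0 : ℝ) ≤ Real.log 32 := Real.log_nonneg (by norm_num)
  have h6 : (2 + δ₀) * Real.log p ≤ 3 * (p ^ ε / ε) := by nlinarith
  calc Real.log (4 * X) ≤ Real.log 32 + (2 + δ₀) * Real.log p := h1
    _ ≤ Real.log 32 * p ^ ε + 3 * (p ^ ε / ε) := by nlinarith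
    _ = (Real.log 32 + 3 / ε) * p ^ ε := by field_simp

/-- `C(4X)^ε ≤ C·32^ε·p^{3ε}` for `X ≤ 8p^{2+δ₀}`, `δ₀ ≤ 1`, `p ≥ 1`. [folklore] -/
theorem D_le {p X δ₀ ε C : ℝ} (hp : 1 ≤ p) (hε : 0 ≤ ε) (hδ1 : δ₀ ≤ 1) (hC : 0 ≤ C)
    (hX0 : 0 < X) (hX : X ≤ 8 * p ^ (2 + δ₀)) : C * (4 * X) ^ ε ≤ C * 32 ^ ε * p ^ (3 * ε) := by
  have hp0 : 0 < p := by linarith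
  have h1 : (4 * X) ^ ε ≤ (32 * p ^ (2 + δ₀)) ^ ε := rpow_le_rpow (by positivity) (by linarith) hε
  have e : (32 * p ^ (2 + δ₀)) ^ ε = 32 ^ ε * p ^ ((2 + δ₀) * ε) := by
    rw [mul_rpow (by norm_num) (by positivity), ← rpow_mul hp0.le]
  rw [e] at h1
  have h2 : p ^ ((2 + δ₀) * ε) ≤ p ^ (3 * ε) :=
    rpow_le_rpow_of_exponent_le hp (by nlinarith)
  calc C * (4 * X) ^ ε ≤ C * (32 ^ ε * p ^ ((2 + δ₀) * ε)) := mul_le_mul_of_nonneg_left h1 hC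
    _ ≤ C * (32 ^ ε * p ^ (3 * ε)) := by gcongr
    _ = C * 32 ^ ε * p ^ (3 * ε) := by ring

/-- `X^{1−η} ≤ 8 p^{2+δ₀−2η}` for `p² ≤ X ≤ 8p^{2+δ₀}`, `η ≥ 0`. [folklore] -/
theorem X_one_sub_le {p X δ₀ η : ℝ} (hp : 0 < p) (hη : 0 ≤ η) (hXlo : p ^ (2 : ℝ) ≤ X)
    (hX : X ≤ 8 * p ^ (2 + δ₀)) : X ^ (1 - η) ≤ 8 * p ^ (2 + δ₀ - 2 * η) := by
  have hX0 : 0 < X := lt_of_lt_of_le (by positivity) hXlo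
  rw [rpow_sub hX0, rpow_one, div_le_iff₀ (rpow_pos_of_pos hX0 η)]
  have h1 : (p ^ (2 : ℝ)) ^ η ≤ X ^ η := rpow_le_rpow (by positivity) hXlo hη
  rw [← rpow_mul hp.le] at h1
  calc X ≤ 8 * p ^ (2 + δ₀) := hX
    _ = 8 * p ^ (2 + δ₀ - 2 * η) * p ^ (2 * η) := by
        rw [mul_assoc, ← rpow_add hp]; ring_nf
    _ ≤ 8 * p ^ (2 + δ₀ - 2 * η) * X ^ η := mul_le_mul_of_nonneg_left h1 (by positivity)

/-- `p^{2−2δ₀} ≤ X^{1−δ₀}` for `p² ≤ X`, `δ₀ ≤ 1`. [folklore] -/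
theorem target_ge {p X δ₀ : ℝ} (hp : 0 < p) (hδ1 : δ₀ ≤ 1) (hXlo : p ^ (2 : ℝ) ≤ X) :
    p ^ (2 - 2 * δ₀) ≤ X ^ (1 - δ₀) := by
  have := rpow_le_rpow (by positivity) hXlo (show (0 : ℝ) ≤ 1 - δ₀ by linarith)
  rw [← rpow_mul hp.le] at this
  convert this using 2; ring

/-- A generic term: `c · p^{e} ≤ θ · X^{1−δ₀}` once `c ≤ θ p^{2−2δ₀−e}` (`p² ≤ X`). [folklore] -/
theorem term_le {p X δ₀ c θ e : ℝ} (hp : 0 < p) (hθ : 0 ≤ θ) (hδ1 : δ₀ ≤ 1) (hXlo : p ^ (2 : ℝ) ≤ X)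
    (hlarge : c ≤ θ * p ^ (2 - 2 * δ₀ - e)) : c * p ^ e ≤ θ * X ^ (1 - δ₀) :=
  (monomial_le hp hlarge).trans (mul_le_mul_of_nonneg_left (target_ge hp hδ1 hXlo) hθ)

/-! ### The prime-power term -/

/-- `√(2q) ≤ 4 p^{(1+δ₀)/2}` for `q ≤ 8p^{1+δ₀}`. [folklore] -/
theorem sqrt_two_mul_le {p q δ₀ : ℝ} (hp : 0 < p) (hasp : q ≤ 8 * p ^ (1 + δ₀)) :
    Real.sqrt (2 * q) ≤ 4 * p ^ ((1 + δ₀) / 2) := by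
  have h1 : Real.sqrt (2 * q) ≤ Real.sqrt (16 * p ^ (1 + δ₀)) := Real.sqrt_le_sqrt (by linarith)
  refine h1.trans (le_of_eq ?_)
  rw [Real.sqrt_mul' _ (rpow_nonneg hp.le _), show (16 : ℝ) = 4 ^ 2 by norm_num,
    Real.sqrt_sq (by norm_num), Real.sqrt_eq_rpow, ← rpow_mul hp.le]
  ring_nf

set_option maxHeartbeats 800000 in
/-- **F23, the prime-power term.** [folklore] -/
theorem fact_E {P₁ P₂ : ℕ} {η C L D : ℝ} (hη : 0 < η) (hη2 : η < 2) (hC : 1 ≤ C) (hP₁ : 3 ≤ P₁)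
    (hP₁P₂ : P₁ ≤ P₂) (hasp : (P₂ : ℝ) ≤ 8 * (P₁ : ℝ) ^ (1 + η / 50))
    (hL : L = Real.log (4 * ((P₁ : ℝ) * P₂))) (hD : D = C * (4 * ((P₁ : ℝ) * P₂)) ^ (η / 1000))
    (hlarge : 1024 * (C * 32 ^ (η / 1000)) ^ 2 * (Real.log 32 + 3 / (η / 1000)) ^ 3 ≤
      (P₁ : ℝ) ^ (1 / 2 - 7 * (η / 50) / 2 - 9 * (η / 1000))) :
    D ^ 2 * L ^ 2 * ((Nat.sqrt (2 * P₁) * Nat.log 2 (2 * P₁) : ℕ) * ((2 * P₂ : ℕ) : ℝ) +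
        ((2 * P₁ : ℕ) : ℝ) * (Nat.sqrt (2 * P₂) * Nat.log 2 (2 * P₂) : ℕ)) ≤
      ((P₁ : ℝ) * P₂) ^ (1 - η / 50) / 4 := by
  set p : ℝ := (P₁ : ℝ) with hpdef
  set q : ℝ := (P₂ : ℝ) with hqdef
  set δ₀ : ℝ := η / 50 with hδdef
  set ε : ℝ := η / 1000 with hεdef
  have hp3 : (3 : ℝ) ≤ p := by rw [hpdef]; exact_mod_cast hP₁
  have hp1 : (1 : ℝ) ≤ p := by linarith
  have hp0 : (0 : ℝ) < p := by linarith
  have hpq : p ≤ q := by rw [hpdef, hqdef]; exact_mod_cast hP₁P₂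
  have hq0 : 0 < q := lt_of_lt_of_le hp0 hpq
  set X : ℝ := p * q with hXdef
  have hX0 : 0 < X := by positivity
  have hXlo : p ^ (2 : ℝ) ≤ X := by rw [rpow_two, hXdef]; nlinarith
  have hX1 : 1 ≤ X := le_trans (one_le_rpow hp1 (by norm_num)) hXlo
  have hXhi : X ≤ 8 * p ^ (2 + δ₀) := X_le hp0 hasp
  have hε0 : 0 < ε := by positivity
  have hδ0 : 0 ≤ δ₀ := by positivity
  have hδ1 : δ₀ ≤ 1 := by rw [hδdef]; linarith
  -- monomial bounds
  have hLb : L ≤ (Real.log 32 + 3 / ε) * p ^ ε := by rw [hL]; exact L_le hp1 hε0 hδ1 hX0 hXhi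
  have hDb : D ≤ C * 32 ^ ε * p ^ (3 * ε) := by
    rw [hD]; exact D_le hp1 hε0.le hδ1 (by linarith) hX0 hXhi
  have hL1 : 1 ≤ L := by rw [hL]; exact fact_L hX1
  have hL0 : 0 ≤ L := by linarith
  have hD1 : 1 ≤ D := by rw [hD]; exact fact_D hX1 hC hε0.le
  have hD0 : 0 ≤ D := by linarith
  set κL : ℝ := Real.log 32 + 3 / ε with hκL
  set κD : ℝ := C * 32 ^ ε with hκD
  have hκL0 : 0 ≤ κL := by rw [hκL]; have := Real.log_nonneg (show (1:ℝ) ≤ 32 by norm_num); positivity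
  have hκD0 : 0 ≤ κD := by rw [hκD]; positivity
  -- the combinatorial factors
  have e2P₁ : ((2 * P₁ : ℕ) : ℝ) = 2 * p := by push_cast; rw [hpdef]
  have e2P₂ : ((2 * P₂ : ℕ) : ℝ) = 2 * q := by push_cast; rw [hqdef]
  have hpp : p * p ≤ p * q := mul_le_mul_of_nonneg_left hpq hp0.le
  have h3p : 3 * p ≤ p * p := by nlinarith
  have hm1' : 2 * p ≤ 4 * (p * q) := by
    have t := mul_le_mul_of_nonneg_left (hpp.trans' h3p) (show (0:ℝ) ≤ 4 by norm_num)
    linarith only [t, hp0]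
  have hm2' : 2 * q ≤ 4 * (p * q) := by
    have t : 3 * q ≤ p * q := mul_le_mul_of_nonneg_right hp3 hq0.le
    linarith only [t, hq0]
  have hm1 : ((2 * P₁ : ℕ) : ℝ) ≤ 4 * X := by rw [e2P₁, hXdef]; exact hm1'
  have hm2 : ((2 * P₂ : ℕ) : ℝ) ≤ 4 * X := by rw [e2P₂, hXdef]; exact hm2'
  have hlog1 : (Nat.log 2 (2 * P₁) : ℝ) ≤ 2 * L := by
    rw [hL]; exact natlog_le (by omega) hm1
  have hlog2 : (Nat.log 2 (2 * P₂) : ℝ) ≤ 2 * L := by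
    rw [hL]; exact natlog_le (by omega) hm2
  have hsq1 : (Nat.sqrt (2 * P₁) : ℝ) ≤ 4 * p ^ ((1 + δ₀) / 2) := by
    refine Real.nat_sqrt_le_real_sqrt.trans ?_
    rw [e2P₁]
    exact (Real.sqrt_le_sqrt (by linarith only [hpq])).trans (sqrt_two_mul_le hp0 hasp)
  have hsq2 : (Nat.sqrt (2 * P₂) : ℝ) ≤ 4 * p ^ ((1 + δ₀) / 2) := by
    refine Real.nat_sqrt_le_real_sqrt.trans ?_
    rw [e2P₂]
    exact sqrt_two_mul_le hp0 hasp
  have hpow0 : 0 ≤ p ^ ((1 + δ₀) / 2) := rpow_nonneg hp0.le _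
  have hA : ((Nat.sqrt (2 * P₁) * Nat.log 2 (2 * P₁) : ℕ) : ℝ) ≤ 4 * p ^ ((1 + δ₀) / 2) * (2 * L) := by
    push_cast
    exact mul_le_mul hsq1 hlog1 (Nat.cast_nonneg _) (by positivity)
  have hB : ((Nat.sqrt (2 * P₂) * Nat.log 2 (2 * P₂) : ℕ) : ℝ) ≤ 4 * p ^ ((1 + δ₀) / 2) * (2 * L) := by
    push_cast
    exact mul_le_mul hsq2 hlog2 (Nat.cast_nonneg _) (by positivity)
  -- the bracket `≤ 32 M q`, `M = p^{(1+δ₀)/2} L`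
  set M : ℝ := p ^ ((1 + δ₀) / 2) * L with hMdef
  have hM0 : 0 ≤ M := by positivity
  have hbr : ((Nat.sqrt (2 * P₁) * Nat.log 2 (2 * P₁) : ℕ) : ℝ) * ((2 * P₂ : ℕ) : ℝ) +
      ((2 * P₁ : ℕ) : ℝ) * (Nat.sqrt (2 * P₂) * Nat.log 2 (2 * P₂) : ℕ) ≤ 32 * M * q := by
    rw [e2P₂, e2P₁]
    have hA' : ((Nat.sqrt (2 * P₁) * Nat.log 2 (2 * P₁) : ℕ) : ℝ) ≤ 8 * M := by
      rw [hMdef]; linarith only [hA]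
    have hB' : ((Nat.sqrt (2 * P₂) * Nat.log 2 (2 * P₂) : ℕ) : ℝ) ≤ 8 * M := by
      rw [hMdef]; linarith only [hB]
    have t1 : ((Nat.sqrt (2 * P₁) * Nat.log 2 (2 * P₁) : ℕ) : ℝ) * (2 * q) ≤ (8 * M) * (2 * q) :=
      mul_le_mul_of_nonneg_right hA' (by positivity)
    have t2 : 2 * p * ((Nat.sqrt (2 * P₂) * Nat.log 2 (2 * P₂) : ℕ) : ℝ) ≤ 2 * p * (8 * M) :=
      mul_le_mul_of_nonneg_left hB' (by positivity)
    have t3 : 2 * p * (8 * M) ≤ 2 * q * (8 * M) := mul_le_mul_of_nonneg_right (by linarith only [hpq]) (by positivity)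
    have e3 : (8 * M) * (2 * q) + 2 * q * (8 * M) = 32 * M * q := by ring
    linarith only [t1, t2, t3, e3]
  -- everything as a monomial: `≤ 256 κD² κL³ p^{9ε + 3(1+δ₀)/2}`
  clear_value κL κD
  have hq8 : q ≤ 8 * p ^ (1 + δ₀) := hasp
  have hD2 : D ^ 2 ≤ κD ^ 2 * p ^ (6 * ε) := by
    have := pow_le_pow_left₀ hD0 hDb 2
    rw [mul_pow, ← rpow_natCast (p ^ (3 * ε)) 2, ← rpow_mul hp0.le] at this
    refine this.trans (le_of_eq ?_); congr 1; norm_num; ring_nf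
  have hL3 : L ^ 3 ≤ κL ^ 3 * p ^ (3 * ε) := by
    have := pow_le_pow_left₀ hL0 hLb 3
    rw [mul_pow, ← rpow_natCast (p ^ ε) 3, ← rpow_mul hp0.le] at this
    refine this.trans (le_of_eq ?_); congr 1; norm_num; ring_nf
  have hcomb : p ^ (6 * ε) * p ^ (3 * ε) * p ^ ((1 + δ₀) / 2) * p ^ (1 + δ₀) =
      p ^ (6 * ε + 3 * ε + ((1 + δ₀) / 2 + (1 + δ₀))) := by
    rw [← rpow_add hp0, ← rpow_add hp0, ← rpow_add hp0]; ring_nf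
  have hmono : D ^ 2 * L ^ 2 * (32 * M * q) ≤
      256 * κD ^ 2 * κL ^ 3 * p ^ (6 * ε + 3 * ε + ((1 + δ₀) / 2 + (1 + δ₀))) := by
    have e : D ^ 2 * L ^ 2 * (32 * M * q) = 32 * (D ^ 2 * (L ^ 3 * (p ^ ((1 + δ₀) / 2) * q))) := by
      rw [hMdef]; ring
    rw [e, ← hcomb]
    have step : D ^ 2 * (L ^ 3 * (p ^ ((1 + δ₀) / 2) * q)) ≤
        (κD ^ 2 * p ^ (6 * ε)) * ((κL ^ 3 * p ^ (3 * ε)) * (p ^ ((1 + δ₀) / 2) * (8 * p ^ (1 + δ₀)))) := by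
      refine mul_le_mul hD2 (mul_le_mul hL3 (mul_le_mul_of_nonneg_left hq8 hpow0) (by positivity)
        (by positivity)) (by positivity) (by positivity)
    refine le_trans (mul_le_mul_of_nonneg_left step (by norm_num)) (le_of_eq ?_)
    ring
  -- compare with the target
  have htarget : 256 * κD ^ 2 * κL ^ 3 * p ^ (6 * ε + 3 * ε + ((1 + δ₀) / 2 + (1 + δ₀))) ≤
      (1 / 4) * X ^ (1 - δ₀) := by
    refine term_le hp0 (by norm_num) hδ1 hXlo ?_
    have e : 2 - 2 * δ₀ - (6 * ε + 3 * ε + ((1 + δ₀) / 2 + (1 + δ₀))) =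
        1 / 2 - 7 * δ₀ / 2 - 9 * ε := by ring
    rw [e]
    have : 256 * κD ^ 2 * κL ^ 3 = (1 / 4) * (1024 * κD ^ 2 * κL ^ 3) := by ring
    rw [this]
    exact mul_le_mul_of_nonneg_left hlarge (by norm_num)
  calc _ ≤ D ^ 2 * L ^ 2 * (32 * M * q) :=
        mul_le_mul_of_nonneg_left hbr (by positivity)
    _ ≤ _ := hmono
    _ ≤ (1 / 4) * X ^ (1 - δ₀) := htarget
    _ = _ := by rw [hXdef]; ring

end Summit.Parity.BatemanHorn.Cruxes.SplitBlockJacobiCorner.Sketch.MbbOfBoxInputs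

namespace Summit.Parity.BatemanHorn.Cruxes.SplitBlockJacobiCorner.Sketch

/-- **Registered stub form** (`√(2P₂) ≤ 4 P₁^{(1+δ₀)/2}` from the aspect bound): restated in `∀`-form in the crux-line namespace under
the name registered on stmt-Parity-15002. [folklore] -/
theorem mbbParamsB_sqrt_two_mul_le :
    ∀ p q δ₀ : ℝ, 0 < p → q ≤ 8 * p ^ (1 + δ₀) → Real.sqrt (2 * q) ≤ 4 * p ^ ((1 + δ₀) / 2) :=
  fun _ _ _ hp hasp => MbbOfBoxInputs.sqrt_two_mul_le hp hasp

end Summit.Parity.BatemanHorn.Cruxes.SplitBlockJacobiCorner.Sketch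

end
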